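import Summits.ResolutionOfSingularities.ResolutionOfSingularities.Theorems.EquisingularLiftCampaignW45bDeltaMultiplicityEngine
import Summits.ResolutionOfSingularities.ResolutionOfSingularities.Theorems.EquisingularLiftCampaignW45bUniqueBadPoint
import Summits.ResolutionOfSingularities.ResolutionOfSingularities.Theorems.EquisingularLiftCampaignW45bStrictTransformMultiplicity
import HarnessLib

/-!
# [OURS · L1 W4.5(b)] T-ΔMULT — multiplicity does not rise in the regular chart of a Δ/COMB step at an equimultiple point

Crux chain w45b, working crux EL♮ = `Theses.EquisingularLift.EquisingularLiftNat` (stmt-ResolutionOfSingularities-20038), research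
stub `stub_elnat_three_isolated`; target **T-ΔMULT** of res-L1-w45b-lead-2 (STATUS 2026-08-27T06:04:05Z), the `w`-CHART half
(the `e`-chart half at rational points is res-L1-w45b-stub-2's L6, `…StrictTransformMultiplicity.lean` p504673; split agreed
06:22:47Z). OURS; NOT a statement of any manuscript; AI-written, weaker than expert review.
`--supports stmt-ResolutionOfSingularities-20038 --as helper`.

SETTING (CRUX-PLAN v3 §1.1, the special fibre of a regular horizontal centre): `R` regular local with closed point `q`,
`e ∈ 𝔪 ∖ 𝔪²`, `w ∈ 𝔪²`, `w ∉ (e)`, `Z = V(e, w)` (Δ-centre trace or comb node), `H = V(y)` EQUIMULTIPLE along `Z` at `q`: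
`y ∈ (e, w)^ν`, `y ∉ 𝔪^{ν+1}`. The `w`-chart of `Bl_Z` is `B′ = R[Z/w] = R[X]/(wX − e)` (p503573), REGULAR over `q` (L2 (iii),
p504070), coordinate `a = e/w`; it contains every point of `Bl_Z` over `q` except the bad point `𝔓₀` of the `e`-chart, where
AVOID-L1 (p501026) gives order `0`. Writing `y = Σ_{j≤ν} p_j e^j w^{ν-j}` (engine §1), the strict transform is `y/w^ν = p(a)` with
`p_ν` a UNIT (engine §§2–3), and reduction to the exceptional line `κ[X]` (engine §5, via p504673's reduction map with
`(a, b) := (w, e)`) bounds every order by a degree count in `κ[X]_𝔮` (engine §4):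

* `le_of_algebraMap_divPow_wChart_mem_pow` / **`deltaMult_wChart_order_le`** — for EVERY prime `𝔓 ⊇ 𝔪B′` of `B′` (rational,
  non-rational, or the generic point of the exceptional line): `y/w^ν ∈ (𝔓B′_𝔓)^n ⇒ n ≤ ν`; in particular
  `ord_𝔓(y/w^ν) ≤ ν` — THE MULTIPLICITY DOES NOT RISE (`divPow_wChart_notMem_pow_succ`: `y/w^ν ∉ 𝔓^{ν+1}` globally);
* `divPow_wChart_notMem_map_maximalIdeal` / `deltaMult_wChart_notMem_map_maximalIdeal` — `y/w^ν ∉ 𝔪B′`: the strict transform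
  does not contain the exceptional line;
* `exists_eq_point_of_algebraMap_divPow_wChart_mem_pow` / **`deltaMult_wChart_point`** — order exactly `ν ≥ 1` happens only at a
  RATIONAL closed point `𝔓 = 𝔪B′ + (e/w − c)`, `c ∈ R` (`p̄ = p̄_ν (X − c̄)^ν`), a maximal ideal (`point_wChart_isMaximal`);
* `eq_of_algebraMap_divPow_wChart_mem_pow` / **`deltaMult_wChart_atMostOne`** — and at AT MOST ONE point over `q`.

§6 states everything for a local DOMAIN `R` with `e ∈ 𝔪`, `w ∈ 𝔪² ∖ 0`, `w ∣ e x ⇒ w ∣ x` (what the chart presentation needs);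
§7 specialises to the line's regular setting (`wChart_hypotheses`: `e` prime, `w ∉ (e)`). Together with AVOID-L1 this is the
«`ν` non-increasing» half of Δ-PERMISSIBILITY (lead-2: equimultiple along the lci trace ⇒ the Δ/COMB step acts on `H` like a
permissible blow-up), the local termination input for `stub_elnat_three_isolated`.

References: res-L1-w45b-lead-2 STATUS 2026-08-27T06:04:05Z «T-ΔMULT», LEAD-MEMO-1 §4; res-L1-w45b-plan-1 CRUX-PLAN v3 §1.1/§1.7
(OURS planning texts); V. Cossart, U. Jannsen, S. Saito, LNM 2270 (2020), §2; J. Kollár, *Lectures on Resolution of Singularities*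
(2007), §3.9 — context only.
-/

noncomputable section

set_option linter.dupNamespace false -- mandated namespace `Summit.<Summit>.<Problem>` of this single-conjunct summit

open IsLocalRing IsLocalization Polynomial
open Literature.AlgebraicGeometry.Resolution

namespace Summit.ResolutionOfSingularities.ResolutionOfSingularities.Cruxes.EquisingularLiftNat.Sections

universe u

/-! ## §6 T-ΔMULT in the `w`-chart `B′ = R[(e,w)/w]` (local domain `R`, `e ∈ 𝔪`, `w ∈ 𝔪² ∖ 0`, `w ∣ ex ⇒ w ∣ x`) -/

section WChart

variable {R : Type u} [CommRing R] [IsLocalRing R] [IsDomain R] {e w : R}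

omit [IsLocalRing R] [IsDomain R] in
/-- `B′ = R[a]`, `a = e/w`: every element of the `w`-chart is a polynomial in the chart coordinate. [folklore] -/
theorem aeval_gen_surjective_wChart :
    Function.Surjective
      (Polynomial.aeval (R := R) (blowupAlgebra.gen (Ideal.span {e, w}) w e (mem_span_pair_left e w))) :=
  aeval_gen_surjective_of_eq (Ideal.span {e, w}) (by rw [Set.pair_comm]) _

/-- **The reduction map of the `w`-chart** `ρ : B′ → κ[X]`, `r ↦ r̄`, `e/w ↦ X` (the tree's
`exists_ringHom_polynomial_residueField`, p504673, instantiated with `(a, b) := (w, e)`): its existence needs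
`ker (R[X] → B′) = (wX − e) ⊆ 𝔪R[X]`, i.e. `w ≠ 0` and `w ∣ e x ⇒ w ∣ x` in the local domain `R`. [folklore] -/
theorem exists_reduction_wChart (he : e ∈ maximalIdeal R) (hw : w ∈ maximalIdeal R) (hw0 : w ≠ 0)
    (hwe : ∀ x : R, w ∣ e * x → w ∣ x) :
    ∃ ρ : blowupAlgebra (Ideal.span {e, w}) w →+* (ResidueField R)[X],
      ∀ p : R[X], ρ (Polynomial.aeval (blowupAlgebra.gen (Ideal.span {e, w}) w e (mem_span_pair_left e w)) p) =
        p.map (residue R) :=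
  exists_ringHom_polynomial_residueField (Ideal.span {e, w}) (by rw [Set.pair_comm]) (mem_span_pair_left e w)
    hw he hw0 hwe

/-- **The strict transform does not contain the exceptional line of the `w`-chart**: `y/w^ν ∉ 𝔪B′`
(its reduction `p̄ ∈ κ[X]` has the unit `p̄_ν` as top coefficient). [folklore; T-ΔMULT (OURS)] -/
theorem divPow_wChart_notMem_map_maximalIdeal (he : e ∈ maximalIdeal R) (hw : w ∈ maximalIdeal R ^ 2)
    (hw0 : w ≠ 0) (hwe : ∀ x : R, w ∣ e * x → w ∣ x) {ν : ℕ} {y : R}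
    (hy : y ∈ Ideal.span {e, w} ^ ν) (hy' : y ∉ maximalIdeal R ^ (ν + 1)) :
    blowupAlgebra.divPow (Ideal.span {e, w}) w hy ∉
      (maximalIdeal R).map (algebraMap R (blowupAlgebra (Ideal.span {e, w}) w)) := by
  have hw₁ : w ∈ maximalIdeal R := Ideal.pow_le_self two_ne_zero hw
  obtain ⟨p, hp, hyp⟩ := exists_polynomial_of_mem_span_pair_pow e w ν hy
  have hu := isUnit_coeff_of_eq_sum_of_notMem_pow he hw p hyp hy'
  obtain ⟨ρ, hρ⟩ := exists_reduction_wChart he hw₁ hw0 hwe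
  intro h
  have h1 := map_maximalIdeal_le_ker_reduction hρ h
  rw [RingHom.mem_ker, divPow_eq_aeval_gen_wChart e w hy p hp hyp, hρ] at h1
  exact map_residue_ne_zero hu h1

/-- **T-ΔMULT, order count.** `R` a local domain, `e ∈ 𝔪`, `w ∈ 𝔪²`, `w ≠ 0`, `w ∣ e x ⇒ w ∣ x`, `y ∈ (e,w)^ν`,
`y ∉ 𝔪^{ν+1}`. For EVERY prime `𝔓` of the `w`-chart `B′ = R[(e,w)/w]` over the closed point (`𝔓 ⊇ 𝔪B′` — rational
or not, closed or the generic point of the exceptional line): if `y/w^ν ∈ (𝔓B′_𝔓)^n` then `n ≤ ν`. Proof: reduce to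
`κ[X]_𝔮`, `𝔮 = ρ(𝔓)`, where `y/w^ν ↦ p̄ ≠ 0` of degree `ν`. [folklore; res-L1-w45b-lead-2 T-ΔMULT (OURS)] -/
theorem le_of_algebraMap_divPow_wChart_mem_pow (he : e ∈ maximalIdeal R) (hw : w ∈ maximalIdeal R ^ 2)
    (hw0 : w ≠ 0) (hwe : ∀ x : R, w ∣ e * x → w ∣ x) {ν : ℕ} {y : R}
    (hy : y ∈ Ideal.span {e, w} ^ ν) (hy' : y ∉ maximalIdeal R ^ (ν + 1))
    (𝔓 : Ideal (blowupAlgebra (Ideal.span {e, w}) w)) [𝔓.IsPrime]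
    (hm : (maximalIdeal R).map (algebraMap R (blowupAlgebra (Ideal.span {e, w}) w)) ≤ 𝔓) {n : ℕ}
    (h : algebraMap (blowupAlgebra (Ideal.span {e, w}) w) (Localization.AtPrime 𝔓)
        (blowupAlgebra.divPow (Ideal.span {e, w}) w hy) ∈ maximalIdeal (Localization.AtPrime 𝔓) ^ n) :
    n ≤ ν := by
  have hw₁ : w ∈ maximalIdeal R := Ideal.pow_le_self two_ne_zero hw
  obtain ⟨p, hp, hyp⟩ := exists_polynomial_of_mem_span_pair_pow e w ν hy
  have hu := isUnit_coeff_of_eq_sum_of_notMem_pow he hw p hyp hy'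
  obtain ⟨ρ, hρ⟩ := exists_reduction_wChart he hw₁ hw0 hwe
  have hsurj := aeval_gen_surjective_wChart (e := e) (w := w)
  haveI := isPrime_map_reduction hsurj hρ 𝔓 hm
  have h1 := algebraMap_reduction_mem_pow hsurj hρ 𝔓 hm h
  rw [divPow_eq_aeval_gen_wChart e w hy p hp hyp, hρ] at h1
  have h2 := le_natDegree_of_algebraMap_mem_pow (𝔓.map ρ) (map_residue_ne_zero hu) h1
  rwa [natDegree_map_residue_eq hp hu] at h2

/-- **T-ΔMULT — the multiplicity does not rise: `ord_𝔓(y/w^ν) ≤ ν`** at every prime `𝔓 ⊇ 𝔪B′` of the `w`-chart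
(hypotheses as in `le_of_algebraMap_divPow_wChart_mem_pow`). [folklore; res-L1-w45b-lead-2 T-ΔMULT (OURS)] -/
theorem algebraMap_divPow_wChart_notMem_pow_succ (he : e ∈ maximalIdeal R) (hw : w ∈ maximalIdeal R ^ 2)
    (hw0 : w ≠ 0) (hwe : ∀ x : R, w ∣ e * x → w ∣ x) {ν : ℕ} {y : R}
    (hy : y ∈ Ideal.span {e, w} ^ ν) (hy' : y ∉ maximalIdeal R ^ (ν + 1))
    (𝔓 : Ideal (blowupAlgebra (Ideal.span {e, w}) w)) [𝔓.IsPrime]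
    (hm : (maximalIdeal R).map (algebraMap R (blowupAlgebra (Ideal.span {e, w}) w)) ≤ 𝔓) :
    algebraMap (blowupAlgebra (Ideal.span {e, w}) w) (Localization.AtPrime 𝔓)
        (blowupAlgebra.divPow (Ideal.span {e, w}) w hy) ∉
      maximalIdeal (Localization.AtPrime 𝔓) ^ (ν + 1) :=
  fun h => Nat.not_succ_le_self ν (le_of_algebraMap_divPow_wChart_mem_pow he hw hw0 hwe hy hy' 𝔓 hm h)

/-- Global reading: `y/w^ν ∉ 𝔓^{ν+1}` for every prime `𝔓 ⊇ 𝔪B′` of the `w`-chart. [folklore] -/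
theorem divPow_wChart_notMem_pow_succ (he : e ∈ maximalIdeal R) (hw : w ∈ maximalIdeal R ^ 2)
    (hw0 : w ≠ 0) (hwe : ∀ x : R, w ∣ e * x → w ∣ x) {ν : ℕ} {y : R}
    (hy : y ∈ Ideal.span {e, w} ^ ν) (hy' : y ∉ maximalIdeal R ^ (ν + 1))
    (𝔓 : Ideal (blowupAlgebra (Ideal.span {e, w}) w)) [𝔓.IsPrime]
    (hm : (maximalIdeal R).map (algebraMap R (blowupAlgebra (Ideal.span {e, w}) w)) ≤ 𝔓) :
    blowupAlgebra.divPow (Ideal.span {e, w}) w hy ∉ 𝔓 ^ (ν + 1) := by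
  intro hb
  apply algebraMap_divPow_wChart_notMem_pow_succ he hw hw0 hwe hy hy' 𝔓 hm
  rw [← Localization.AtPrime.map_eq_maximalIdeal, ← Ideal.map_pow]
  exact Ideal.mem_map_of_mem _ hb

/-- **Order exactly `ν` pins a rational point**: if `ν ≥ 1` and `y/w^ν ∈ (𝔓B′_𝔓)^ν` for a prime `𝔓 ⊇ 𝔪B′`, then
`𝔓 = 𝔪B′ + (e/w − c)` for some `c ∈ R` — the rational point `a = c̄` of the exceptional line with `p̄ = p̄_ν (X − c̄)^ν`.
[folklore; res-L1-w45b-lead-2 T-ΔMULT (OURS)] -/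
theorem exists_eq_point_of_algebraMap_divPow_wChart_mem_pow (he : e ∈ maximalIdeal R)
    (hw : w ∈ maximalIdeal R ^ 2) (hw0 : w ≠ 0) (hwe : ∀ x : R, w ∣ e * x → w ∣ x) {ν : ℕ} (hν : 1 ≤ ν)
    {y : R} (hy : y ∈ Ideal.span {e, w} ^ ν) (hy' : y ∉ maximalIdeal R ^ (ν + 1))
    (𝔓 : Ideal (blowupAlgebra (Ideal.span {e, w}) w)) [𝔓.IsPrime]
    (hm : (maximalIdeal R).map (algebraMap R (blowupAlgebra (Ideal.span {e, w}) w)) ≤ 𝔓)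
    (h : algebraMap (blowupAlgebra (Ideal.span {e, w}) w) (Localization.AtPrime 𝔓)
        (blowupAlgebra.divPow (Ideal.span {e, w}) w hy) ∈ maximalIdeal (Localization.AtPrime 𝔓) ^ ν) :
    ∃ c : R, 𝔓 = (maximalIdeal R).map (algebraMap R (blowupAlgebra (Ideal.span {e, w}) w)) ⊔
      Ideal.span {blowupAlgebra.gen (Ideal.span {e, w}) w e (mem_span_pair_left e w) -
        algebraMap R (blowupAlgebra (Ideal.span {e, w}) w) c} := by
  have hw₁ : w ∈ maximalIdeal R := Ideal.pow_le_self two_ne_zero hw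
  obtain ⟨p, hp, hyp⟩ := exists_polynomial_of_mem_span_pair_pow e w ν hy
  have hu := isUnit_coeff_of_eq_sum_of_notMem_pow he hw p hyp hy'
  obtain ⟨ρ, hρ⟩ := exists_reduction_wChart he hw₁ hw0 hwe
  have hsurj := aeval_gen_surjective_wChart (e := e) (w := w)
  haveI := isPrime_map_reduction hsurj hρ 𝔓 hm
  have h1 := algebraMap_reduction_mem_pow hsurj hρ 𝔓 hm h
  rw [divPow_eq_aeval_gen_wChart e w hy p hp hyp, hρ] at h1
  have hdeg : (p.map (residue R)).natDegree = ν := natDegree_map_residue_eq hp hu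
  rw [← hdeg] at h1 hν
  obtain ⟨a₀, h𝔮, -⟩ :=
    eq_span_X_sub_C_of_algebraMap_mem_pow_natDegree (𝔓.map ρ) (map_residue_ne_zero hu) hν h1
  obtain ⟨c, hc⟩ := residue_surjective a₀
  refine ⟨c, ?_⟩
  rw [← comap_reduction_span_X_sub_C hsurj hρ c, hc, ← h𝔮]
  exact (comap_map_reduction hsurj hρ 𝔓 hm).symm

/-- The rational points `𝔪B′ + (e/w − c)` of the `w`-chart are maximal ideals (closed points with residue field `κ`).
[folklore] -/
theorem point_wChart_isMaximal (he : e ∈ maximalIdeal R) (hw : w ∈ maximalIdeal R) (hw0 : w ≠ 0)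
    (hwe : ∀ x : R, w ∣ e * x → w ∣ x) (c : R) :
    ((maximalIdeal R).map (algebraMap R (blowupAlgebra (Ideal.span {e, w}) w)) ⊔
      Ideal.span {blowupAlgebra.gen (Ideal.span {e, w}) w e (mem_span_pair_left e w) -
        algebraMap R (blowupAlgebra (Ideal.span {e, w}) w) c}).IsMaximal := by
  obtain ⟨ρ, hρ⟩ := exists_reduction_wChart he hw hw0 hwe
  exact isMaximal_map_sup_span_gen_sub (aeval_gen_surjective_wChart (e := e) (w := w)) hρ c

/-- **Order `ν` occurs at AT MOST ONE point over the closed point** (`ν ≥ 1`): two primes `𝔓₁, 𝔓₂ ⊇ 𝔪B′` of the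
`w`-chart with `y/w^ν ∈ (𝔓ᵢB′_{𝔓ᵢ})^ν` coincide — `p̄ = p̄_ν (X − ā₁)^ν = p̄_ν (X − ā₂)^ν` forces `ā₁ = ā₂`.
[folklore; res-L1-w45b-lead-2 T-ΔMULT (OURS)] -/
theorem eq_of_algebraMap_divPow_wChart_mem_pow (he : e ∈ maximalIdeal R) (hw : w ∈ maximalIdeal R ^ 2)
    (hw0 : w ≠ 0) (hwe : ∀ x : R, w ∣ e * x → w ∣ x) {ν : ℕ} (hν : 1 ≤ ν) {y : R}
    (hy : y ∈ Ideal.span {e, w} ^ ν) (hy' : y ∉ maximalIdeal R ^ (ν + 1))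
    (𝔓₁ 𝔓₂ : Ideal (blowupAlgebra (Ideal.span {e, w}) w)) [𝔓₁.IsPrime] [𝔓₂.IsPrime]
    (hm₁ : (maximalIdeal R).map (algebraMap R (blowupAlgebra (Ideal.span {e, w}) w)) ≤ 𝔓₁)
    (hm₂ : (maximalIdeal R).map (algebraMap R (blowupAlgebra (Ideal.span {e, w}) w)) ≤ 𝔓₂)
    (h₁ : algebraMap (blowupAlgebra (Ideal.span {e, w}) w) (Localization.AtPrime 𝔓₁)
        (blowupAlgebra.divPow (Ideal.span {e, w}) w hy) ∈ maximalIdeal (Localization.AtPrime 𝔓₁) ^ ν)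
    (h₂ : algebraMap (blowupAlgebra (Ideal.span {e, w}) w) (Localization.AtPrime 𝔓₂)
        (blowupAlgebra.divPow (Ideal.span {e, w}) w hy) ∈ maximalIdeal (Localization.AtPrime 𝔓₂) ^ ν) :
    𝔓₁ = 𝔓₂ := by
  have hw₁ : w ∈ maximalIdeal R := Ideal.pow_le_self two_ne_zero hw
  obtain ⟨p, hp, hyp⟩ := exists_polynomial_of_mem_span_pair_pow e w ν hy
  have hu := isUnit_coeff_of_eq_sum_of_notMem_pow he hw p hyp hy'
  obtain ⟨ρ, hρ⟩ := exists_reduction_wChart he hw₁ hw0 hwe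
  have hsurj := aeval_gen_surjective_wChart (e := e) (w := w)
  have hP0 := map_residue_ne_zero (R := R) hu
  have hdeg : (p.map (residue R)).natDegree = ν := natDegree_map_residue_eq hp hu
  haveI := isPrime_map_reduction hsurj hρ 𝔓₁ hm₁
  haveI := isPrime_map_reduction hsurj hρ 𝔓₂ hm₂
  have k₁ := algebraMap_reduction_mem_pow hsurj hρ 𝔓₁ hm₁ h₁
  have k₂ := algebraMap_reduction_mem_pow hsurj hρ 𝔓₂ hm₂ h₂
  rw [divPow_eq_aeval_gen_wChart e w hy p hp hyp, hρ] at k₁ k₂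
  rw [← hdeg] at k₁ k₂ hν
  obtain ⟨a₁, h𝔮₁, hP₁⟩ := eq_span_X_sub_C_of_algebraMap_mem_pow_natDegree (𝔓₁.map ρ) hP0 hν k₁
  obtain ⟨a₂, h𝔮₂, hP₂⟩ := eq_span_X_sub_C_of_algebraMap_mem_pow_natDegree (𝔓₂.map ρ) hP0 hν k₂
  -- `a₁ = a₂`: evaluate `(X − a₁)^ν = (X − a₂)^ν` at `a₁`
  have ha : a₁ = a₂ := by
    have hlc : C (p.map (residue R)).leadingCoeff ≠ 0 := by
      rw [Ne, C_eq_zero, leadingCoeff_eq_zero]; exact hP0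
    have heq := mul_left_cancel₀ hlc (hP₁.symm.trans hP₂)
    have hroot := congrArg (Polynomial.eval a₁) heq
    simp only [eval_pow, eval_sub, eval_X, eval_C, sub_self, zero_pow (by omega : (p.map (residue R)).natDegree ≠ 0)]
      at hroot
    exact sub_eq_zero.mp ((pow_eq_zero_iff (by omega)).mp hroot.symm)
  rw [← comap_map_reduction hsurj hρ 𝔓₁ hm₁, ← comap_map_reduction hsurj hρ 𝔓₂ hm₂, h𝔮₁, h𝔮₂, ha]

end WChart

/-! ## §7 The downstairs setting of the line: `R` regular local, `e ∈ 𝔪 ∖ 𝔪²`, `w ∈ 𝔪² ∖ (e)` -/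

section Regular

variable {R : Type u} [CommRing R] [IsRegularLocalRing R] {e w : R}

/-- In the line's setting `w ≠ 0` and `w ∣ e x ⇒ w ∣ x` (`e` is prime, `w ∉ (e)`; tree `dvd_of_dvd_prime_mul_of_not_dvd`).
[folklore] -/
theorem wChart_hypotheses (he : e ∈ maximalIdeal R) (he₂ : e ∉ maximalIdeal R ^ 2) (hwe : w ∉ Ideal.span {e}) :
    w ≠ 0 ∧ ∀ x : R, w ∣ e * x → w ∣ x := by
  haveI := isDomain_of_isRegularLocalRing R
  have hprime : Prime e := IsRegularLocalRing.prime_of_not_mem_sq he he₂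
  exact ⟨fun h0 => hwe (h0 ▸ Ideal.zero_mem _), dvd_of_dvd_prime_mul_of_not_dvd hprime hwe⟩

/-- **T-ΔMULT (the line's form) — multiplicity does not rise in the `w`-chart of a Δ/COMB step at an equimultiple
point.** `R` regular local, `e ∈ 𝔪 ∖ 𝔪²`, `w ∈ 𝔪²`, `w ∉ (e)` (`Z = V(e,w)` the lci trace), `H = V(y)` with `y ∈ (e,w)^ν`,
`y ∉ 𝔪^{ν+1}` (equimultiple). Then at EVERY prime `𝔓 ⊇ 𝔪B′` of the regular chart `B′ = R[Z/w]` the strict transform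
has `ord_𝔓(y/w^ν) ≤ ν`: `y/w^ν ∉ (𝔓B′_𝔓)^{ν+1}`. With AVOID-L1 (p501026: order `0` at the bad point of the `e`-chart, the
only point over `q` outside the `w`-chart) this is the «`ν` non-increasing» half of Δ-permissibility. [folklore;
res-L1-w45b-lead-2 T-ΔMULT 2026-08-27 (OURS); CJS 2020 §2 context] -/
theorem deltaMult_wChart_order_le (he : e ∈ maximalIdeal R) (he₂ : e ∉ maximalIdeal R ^ 2)
    (hw : w ∈ maximalIdeal R ^ 2) (hwe : w ∉ Ideal.span {e}) {ν : ℕ} {y : R}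
    (hy : y ∈ Ideal.span {e, w} ^ ν) (hy' : y ∉ maximalIdeal R ^ (ν + 1))
    (𝔓 : Ideal (blowupAlgebra (Ideal.span {e, w}) w)) [𝔓.IsPrime]
    (hm : (maximalIdeal R).map (algebraMap R (blowupAlgebra (Ideal.span {e, w}) w)) ≤ 𝔓) :
    algebraMap (blowupAlgebra (Ideal.span {e, w}) w) (Localization.AtPrime 𝔓)
        (blowupAlgebra.divPow (Ideal.span {e, w}) w hy) ∉
      maximalIdeal (Localization.AtPrime 𝔓) ^ (ν + 1) := by
  haveI := isDomain_of_isRegularLocalRing R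
  obtain ⟨hw0, hwe'⟩ := wChart_hypotheses he he₂ hwe
  exact algebraMap_divPow_wChart_notMem_pow_succ he hw hw0 hwe' hy hy' 𝔓 hm

/-- **T-ΔMULT, general order count** in the line's setting: `y/w^ν ∈ (𝔓B′_𝔓)^n ⇒ n ≤ ν`. [folklore; T-ΔMULT (OURS)] -/
theorem deltaMult_wChart_le (he : e ∈ maximalIdeal R) (he₂ : e ∉ maximalIdeal R ^ 2)
    (hw : w ∈ maximalIdeal R ^ 2) (hwe : w ∉ Ideal.span {e}) {ν : ℕ} {y : R}
    (hy : y ∈ Ideal.span {e, w} ^ ν) (hy' : y ∉ maximalIdeal R ^ (ν + 1))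
    (𝔓 : Ideal (blowupAlgebra (Ideal.span {e, w}) w)) [𝔓.IsPrime]
    (hm : (maximalIdeal R).map (algebraMap R (blowupAlgebra (Ideal.span {e, w}) w)) ≤ 𝔓) {n : ℕ}
    (h : algebraMap (blowupAlgebra (Ideal.span {e, w}) w) (Localization.AtPrime 𝔓)
        (blowupAlgebra.divPow (Ideal.span {e, w}) w hy) ∈ maximalIdeal (Localization.AtPrime 𝔓) ^ n) :
    n ≤ ν := by
  haveI := isDomain_of_isRegularLocalRing R
  obtain ⟨hw0, hwe'⟩ := wChart_hypotheses he he₂ hwe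
  exact le_of_algebraMap_divPow_wChart_mem_pow he hw hw0 hwe' hy hy' 𝔓 hm h

/-- **T-ΔMULT — the strict transform does not contain the exceptional line** (`y/w^ν ∉ 𝔪B′`). [folklore; T-ΔMULT (OURS)] -/
theorem deltaMult_wChart_notMem_map_maximalIdeal (he : e ∈ maximalIdeal R) (he₂ : e ∉ maximalIdeal R ^ 2)
    (hw : w ∈ maximalIdeal R ^ 2) (hwe : w ∉ Ideal.span {e}) {ν : ℕ} {y : R}
    (hy : y ∈ Ideal.span {e, w} ^ ν) (hy' : y ∉ maximalIdeal R ^ (ν + 1)) :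
    blowupAlgebra.divPow (Ideal.span {e, w}) w hy ∉
      (maximalIdeal R).map (algebraMap R (blowupAlgebra (Ideal.span {e, w}) w)) := by
  haveI := isDomain_of_isRegularLocalRing R
  obtain ⟨hw0, hwe'⟩ := wChart_hypotheses he he₂ hwe
  exact divPow_wChart_notMem_map_maximalIdeal he hw hw0 hwe' hy hy'

/-- **T-ΔMULT — order `= ν` at no more than ONE point over the closed point** (`ν ≥ 1`), in the line's setting.
[folklore; res-L1-w45b-lead-2 T-ΔMULT (OURS)] -/
theorem deltaMult_wChart_atMostOne (he : e ∈ maximalIdeal R) (he₂ : e ∉ maximalIdeal R ^ 2)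
    (hw : w ∈ maximalIdeal R ^ 2) (hwe : w ∉ Ideal.span {e}) {ν : ℕ} (hν : 1 ≤ ν) {y : R}
    (hy : y ∈ Ideal.span {e, w} ^ ν) (hy' : y ∉ maximalIdeal R ^ (ν + 1))
    (𝔓₁ 𝔓₂ : Ideal (blowupAlgebra (Ideal.span {e, w}) w)) [𝔓₁.IsPrime] [𝔓₂.IsPrime]
    (hm₁ : (maximalIdeal R).map (algebraMap R (blowupAlgebra (Ideal.span {e, w}) w)) ≤ 𝔓₁)
    (hm₂ : (maximalIdeal R).map (algebraMap R (blowupAlgebra (Ideal.span {e, w}) w)) ≤ 𝔓₂)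
    (h₁ : algebraMap (blowupAlgebra (Ideal.span {e, w}) w) (Localization.AtPrime 𝔓₁)
        (blowupAlgebra.divPow (Ideal.span {e, w}) w hy) ∈ maximalIdeal (Localization.AtPrime 𝔓₁) ^ ν)
    (h₂ : algebraMap (blowupAlgebra (Ideal.span {e, w}) w) (Localization.AtPrime 𝔓₂)
        (blowupAlgebra.divPow (Ideal.span {e, w}) w hy) ∈ maximalIdeal (Localization.AtPrime 𝔓₂) ^ ν) :
    𝔓₁ = 𝔓₂ := by
  haveI := isDomain_of_isRegularLocalRing R
  obtain ⟨hw0, hwe'⟩ := wChart_hypotheses he he₂ hwe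
  exact eq_of_algebraMap_divPow_wChart_mem_pow he hw hw0 hwe' hν hy hy' 𝔓₁ 𝔓₂ hm₁ hm₂ h₁ h₂

/-- **T-ΔMULT — and that point, if present, is the rational closed point `e/w = c̄`**: `𝔓 = 𝔪B′ + (e/w − c)`, a
maximal ideal of the chart (so the `w`-chart is regular there by L2 (iii), p504070). [folklore; T-ΔMULT (OURS)] -/
theorem deltaMult_wChart_point (he : e ∈ maximalIdeal R) (he₂ : e ∉ maximalIdeal R ^ 2)
    (hw : w ∈ maximalIdeal R ^ 2) (hwe : w ∉ Ideal.span {e}) {ν : ℕ} (hν : 1 ≤ ν) {y : R}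
    (hy : y ∈ Ideal.span {e, w} ^ ν) (hy' : y ∉ maximalIdeal R ^ (ν + 1))
    (𝔓 : Ideal (blowupAlgebra (Ideal.span {e, w}) w)) [𝔓.IsPrime]
    (hm : (maximalIdeal R).map (algebraMap R (blowupAlgebra (Ideal.span {e, w}) w)) ≤ 𝔓)
    (h : algebraMap (blowupAlgebra (Ideal.span {e, w}) w) (Localization.AtPrime 𝔓)
        (blowupAlgebra.divPow (Ideal.span {e, w}) w hy) ∈ maximalIdeal (Localization.AtPrime 𝔓) ^ ν) :
    ∃ c : R, 𝔓 = (maximalIdeal R).map (algebraMap R (blowupAlgebra (Ideal.span {e, w}) w)) ⊔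
        Ideal.span {blowupAlgebra.gen (Ideal.span {e, w}) w e (mem_span_pair_left e w) -
          algebraMap R (blowupAlgebra (Ideal.span {e, w}) w) c} ∧ 𝔓.IsMaximal := by
  haveI := isDomain_of_isRegularLocalRing R
  obtain ⟨hw0, hwe'⟩ := wChart_hypotheses he he₂ hwe
  have hw₁ : w ∈ maximalIdeal R := Ideal.pow_le_self two_ne_zero hw
  obtain ⟨c, hc⟩ := exists_eq_point_of_algebraMap_divPow_wChart_mem_pow he hw hw0 hwe' hν hy hy' 𝔓 hm h
  exact ⟨c, hc, hc ▸ point_wChart_isMaximal he hw₁ hw0 hwe' c⟩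

end Regular

end Summit.ResolutionOfSingularities.ResolutionOfSingularities.Cruxes.EquisingularLiftNat.Sections

end
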